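import Summits.HodgeConjecture.HodgeConjecture.Theses.MilnorKExponential
import Literature.AlgebraicGeometry.HodgeTheory.SymbolClasses
import Literature.NumberTheory.Transcendental.Analytification

/-!
# Route MilnorKExponential — objects the line `NashDescentSketch` posits (definitions)

Definitions used by the `--supports` files of the crux `SymbolClassesAlgebraic`
(stmt-HodgeConjecture-17743, GK_p: rational Milnor-symbol classes of weight `q + 1` are algebraic) on
the line `NashDescentSketch` (crux workfile `Cruxes/SymbolClassesAlgebraic/Lines/NashDescentSketch.lean`,
idea card `Cruxes/SymbolClassesAlgebraic/Ideas/nash-descent-weight-kill.md`): insert the étale site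
between the analytic and the Zariski one.

* `IsNashUnitOn A W f` — `f` is a holomorphic unit on `W ⊆ X^an` whose germ at every point of `W` is
  algebraic over the regular functions of `X` (a section of `ε^* 𝔾_m`, `ε : X^an → X_ét` Artin's
  comparison of sites; Artin 1969: the henselisation is the ring of algebraic elements of the completion);
  `IsNashGoodTuple`, `nashMilnorRel` (the naive Milnor relations with Nash witnesses, `≤ milnorRel`),
  `IsNashSymbolCocycle` (`→ IsMilnorSymbolCocycle`), `HasNashSymbolCocycle` (`→ HasSymbolCocycle`),
  `IsNashSymbolClass` (`→ IsSymbolClass`): the tree's `SymbolClasses` vocabulary with NASH units.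
* Named statement forms (route-posited STATEMENTS, not results of the literature): `GKNamed` (the crux
  in guarded named form, bridged both ways to the route decl: `route_of_gkNamed`, `gkNamed_of_route`),
  `HodgeTypeNamed` (the support item `SymbolClassesHodgeType` named), and the line's stubs `NashDescent`
  (A), `NashSymbolConiveauOne` (W₁), `NashSymbolClassesAlgebraicHigh` (W_alg, weights `≥ 3`),
  `NashSymbolClassesAlgebraic` (W_alg), `AlgebraicClassesAreNashSymbolClasses` (Alg ⊆ L_Nash); and the
  3-line record `nashDescent_of_gk` (A ⇐ GK ∧ Alg ⊆ L_Nash: stub A is GK through `ε`).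

Nothing here is conjectural-as-theorem: every statement is a `def … : Prop`; the composition of the
line (`SymbolClassesAlgebraic_of`, sorried at the stubs) lives in the crux workfile, and stub proofs
land as `MilnorKExponentialSymbolClassesAlgebraic<Stub>.lean`.

## References

* [Artin1969] M. Artin, Algebraic approximation of structures over complete local rings, Publ. Math.
  IHÉS 36 (1969), Thm. 1.10 and §2.
* [BlochLectures2010] S. Bloch, Lectures on Algebraic Cycles, 2nd ed., Lecture 6 (analytic `𝒦₂`, `dlog`).
* [Esnault1990CycleMap] H. Esnault, A note on the cycle map, J. reine angew. Math. 411 (1990), §3.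
* [DeligneHodgeII1971] P. Deligne, Théorie de Hodge II, Publ. Math. IHÉS 40 (1971), 3.2.5, 3.2.15–17.
* [BlochOgus1974ENS] S. Bloch, A. Ogus, Gersten's conjecture and the homology of schemes, Ann. Sci.
  ÉNS 7 (1974), (7.6).
* [Deligne2000] P. Deligne, The Hodge conjecture (Clay problem description), §1.
-/

noncomputable section

open scoped Manifold Topology
open CategoryTheory AlgebraicGeometry Filter

-- `Summit.HodgeConjecture.HodgeConjecture.Theorems` is the mandated namespace (single-problem summit:
-- Problem = Summit), which `linter.dupNamespace` flags on every declaration.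
set_option linter.dupNamespace false

namespace Summit.HodgeConjecture.HodgeConjecture.Theorems.MilnorKExponentialNash

open Literature.AlgebraicGeometry Literature.AlgebraicGeometry.HodgeTheory
  Literature.AlgebraicGeometry.Motives Literature.Geometry.Kaehler
  Literature.NumberTheory.Transcendental

/-! ### Nash units, Nash Milnor relations, Nash symbol cocycles and classes -/

section Defs

variable {n : ℕ} {X : SchemeOver ℂ}

/-- **`f` is a NASH unit on `W ⊆ X^an`** (for the Hodge model `A` of `X`): `f` is an invertible
holomorphic function on `W` (`IsHolUnitOn`) and at every point `x ∈ W` the germ of `f` is ALGEBRAIC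
over the regular functions of `X`: there are an affine open `U ∋ x` of `X`, a degree `d` and regular
coefficients `a₀, …, a_d ∈ Γ(X, U)`, one of which is not identically zero near `x` (`∃ᶠ`), with
`Σᵢ aᵢ(y) · f(y)^i = 0` for all `y ∈ W` near `x` (values of regular functions at complex points via
the total evaluation `AlgPoints.evalOrZero`, pulled back along `A.toComplexPoints`). Equivalently
(Artin 1969: `𝒪^h_{X,x}` = the elements of `𝒪^an_{X,x}` algebraic over `𝒪_{X,x}`) `f` is a section
over `W` of the sheaf `ε^* 𝔾_m` of units of the étale site pulled back to `X^an`.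
[cite: Artin1969, Thm. 1.10 and §2] -/
def IsNashUnitOn (A : HodgeModel n X) (W : Set A.carrier) (f : A.carrier → ℂ) : Prop :=
  IsHolUnitOn A.model W f ∧
    ∀ x ∈ W, ∃ (U : X.left.affineOpens) (d : ℕ) (a : Fin (d + 1) → Γ(X.left, (↑U : X.left.Opens))),
      (A.toComplexPoints x).pt ∈ (↑U : X.left.Opens) ∧
      (∃ i, ∃ᶠ y in 𝓝 x, AlgPoints.evalOrZero (↑U : X.left.Opens) (a i) (A.toComplexPoints y) ≠ 0) ∧
      ∀ᶠ y in 𝓝 x, y ∈ W →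
        ∑ i, AlgPoints.evalOrZero (↑U : X.left.Opens) (a i) (A.toComplexPoints y) * f y ^ (i : ℕ) = 0

/-- A Nash unit is a holomorphic unit. [folklore] -/
theorem IsNashUnitOn.isHolUnitOn {A : HodgeModel n X} {W : Set A.carrier} {f : A.carrier → ℂ}
    (h : IsNashUnitOn A W f) : IsHolUnitOn A.model W f :=
  h.1

/-- **A Nash-good `p`-tuple on `W`**: every entry is a Nash unit on `W` (a Milnor symbol of Nash
units; Bloch, Lecture 6, for the analytic `𝒦₂`). [cite: BlochLectures2010, Lecture 6] -/
def IsNashGoodTuple (A : HodgeModel n X) (W : Set A.carrier) {p : ℕ} (t : Fin p → A.carrier → ℂ) :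
    Prop :=
  ∀ i, IsNashUnitOn A W (t i)

/-- A Nash-good tuple is a good tuple. [folklore] -/
theorem IsNashGoodTuple.isGoodTuple {A : HodgeModel n X} {W : Set A.carrier} {p : ℕ}
    {t : Fin p → A.carrier → ℂ} (h : IsNashGoodTuple A W t) : IsGoodTuple A.model W t :=
  fun i ↦ (h i).isHolUnitOn

/-- **The naive Milnor relations with NASH witnesses** in weight `p` over `W`: the subgroup of the
chains generated by (a) `[t] - [t']` for Nash-good tuples agreeing on `W`, (b) multilinearity
`[…, tᵢ g, …] - [t] - […, g, …]` for a Nash-good tuple `t` and a Nash unit `g`, (c) the Steinberg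
relation `[t]` for a Nash-good tuple with `tᵢ + tⱼ = 1` on `W`, `i ≠ j`. Contained in `milnorRel`
(the same presentation as the tree's `milnorRel`, Esnault 1990 §3 for `𝒦_{2,an}`).
[cite: Esnault1990CycleMap, §3] -/
def nashMilnorRel (A : HodgeModel n X) (W : Set A.carrier) (p : ℕ) :
    AddSubgroup ((Fin p → A.carrier → ℂ) →₀ ℤ) :=
  AddSubgroup.closure
    ({s | ∃ t t' : Fin p → A.carrier → ℂ, IsNashGoodTuple A W t ∧ IsNashGoodTuple A W t' ∧
        (∀ i, ∀ x ∈ W, t i x = t' i x) ∧ s = Finsupp.single t 1 - Finsupp.single t' 1} ∪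
      {s | ∃ (t : Fin p → A.carrier → ℂ) (i : Fin p) (g : A.carrier → ℂ), IsNashGoodTuple A W t ∧
        IsNashUnitOn A W g ∧
        s = Finsupp.single (Function.update t i (t i * g)) 1 - Finsupp.single t 1 -
          Finsupp.single (Function.update t i g) 1} ∪
      {s | ∃ (t : Fin p → A.carrier → ℂ) (i j : Fin p), IsNashGoodTuple A W t ∧ i ≠ j ∧
        (∀ x ∈ W, t i x + t j x = 1) ∧ s = Finsupp.single t 1})

/-- The Nash Milnor relations are Milnor relations. [folklore] -/
theorem nashMilnorRel_le_milnorRel (A : HodgeModel n X) (W : Set A.carrier) (p : ℕ) :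
    nashMilnorRel A W p ≤ milnorRel A.model W p := by
  refine (AddSubgroup.closure_le _).2 ?_
  rintro s ((⟨t, t', ht, ht', he, rfl⟩ | ⟨t, i, g, ht, hg, rfl⟩) | ⟨t, i, j, ht, hij, h1, rfl⟩)
  · exact single_sub_single_mem_milnorRel ht.isGoodTuple ht'.isGoodTuple he
  · exact multilinear_mem_milnorRel ht.isGoodTuple i hg.isHolUnitOn
  · exact steinberg_mem_milnorRel ht.isGoodTuple hij h1

/-- **Nash Milnor symbol cocycles** of an open cover `U` of `X^an`: every tuple of every `σ_J` is a
Nash-good tuple on `U_J`, and `(δσ)_{J'}` lies in the NASH Milnor relations over `U_{J'}` (the tree's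
`IsMilnorSymbolCocycle` with Nash data). [cite: Esnault1990CycleMap, §3] -/
def IsNashSymbolCocycle (A : HodgeModel n X) {ι : Type*} (U : ι → Set A.carrier) {m p : ℕ}
    (σ : (Fin (m + 1) → ι) → ((Fin p → A.carrier → ℂ) →₀ ℤ)) : Prop :=
  (∀ J, ∀ t ∈ (σ J).support, IsNashGoodTuple A (cechSet U J) t) ∧
    ∀ J' : Fin (m + 2) → ι, symbolδ σ J' ∈ nashMilnorRel A (cechSet U J') p

/-- A Nash symbol cocycle is a Milnor symbol cocycle. [folklore] -/
theorem IsNashSymbolCocycle.isMilnorSymbolCocycle {A : HodgeModel n X} {ι : Type*}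
    {U : ι → Set A.carrier} {m p : ℕ} {σ : (Fin (m + 1) → ι) → ((Fin p → A.carrier → ℂ) →₀ ℤ)}
    (h : IsNashSymbolCocycle A U σ) : IsMilnorSymbolCocycle A.model U σ :=
  ⟨fun J t ht ↦ (h.1 J t ht).isGoodTuple, fun J' ↦ nashMilnorRel_le_milnorRel A _ p (h.2 J')⟩

/-- **The class `c` is carried on `A` by a NASH symbol cocycle of weight `q + 1`**: the tree's
`HodgeModel.HasSymbolCocycle` with `IsMilnorSymbolCocycle` replaced by `IsNashSymbolCocycle` (same
finite open cover, same Čech–de Rham transgression `IsTransgression`, same `m ≠ 0`).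
[cite: BlochLectures2010, Lecture 6 (proof of Thm. 6.1)] -/
def HasNashSymbolCocycle (A : HodgeModel n X) (q : ℕ) (c : complexBetti X (2 * (q + 1))) : Prop :=
  ∃ (ι : Type) (_ : Fintype ι) (U : ι → Set A.carrier) (hU : ∀ i, IsOpen (U i))
    (_ : ∀ x, ∃ i, x ∈ U i) (σ : (Fin (q + 2) → ι) → ((Fin (q + 1) → (A.carrier → ℂ)) →₀ ℤ))
    (_ : IsNashSymbolCocycle A U σ)
    (θ : cclosedSmoothForms A.model A.carrier (2 * q + 1 + 1)) (m : ℤ),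
    m ≠ 0 ∧ IsTransgression hU q (fun J ↦ symbolForm A.model (q + 1) (σ J)) θ ∧
      A.deRham A.carrier (2 * q + 1 + 1)
          (complexDeRhamCohomology.mk A.model A.carrier (2 * q + 1 + 1) θ) =
        (m : ℂ) • A.pullback (2 * q + 1 + 1) c

/-- A Nash symbol cocycle for `c` is a symbol cocycle for `c`. [folklore] -/
theorem HasNashSymbolCocycle.hasSymbolCocycle {A : HodgeModel n X} {q : ℕ}
    {c : complexBetti X (2 * (q + 1))} (h : HasNashSymbolCocycle A q c) : A.HasSymbolCocycle q c := by
  obtain ⟨ι, hι, U, hU, hcov, σ, hσ, θ, m, hm, hT, hdR⟩ := h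
  exact ⟨ι, hι, U, hU, hcov, σ, hσ.isMilnorSymbolCocycle, θ, m, hm, hT, hdR⟩

variable (n X) in
/-- **Nash symbol classes of weight `q + 1`**: `IsSymbolClass` with a NASH cocycle (same guard: the
model is symbol-normalised as soon as `H^{2(q+1)}(X(ℂ); ℂ) ≠ 0`).
[cite: BlochLectures2010, Lecture 6 (proof of Thm. 6.1)] -/
def IsNashSymbolClass (q : ℕ) (c : complexBetti X (2 * (q + 1))) : Prop :=
  ∃ A : HodgeModel n X,
    (Nontrivial (complexBetti X (2 * (q + 1))) → A.IsSymbolNormalized q) ∧ HasNashSymbolCocycle A q c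

/-- A Nash symbol class is a symbol class. [folklore] -/
theorem IsNashSymbolClass.isSymbolClass {q : ℕ} {c : complexBetti X (2 * (q + 1))}
    (h : IsNashSymbolClass n X q c) : IsSymbolClass n X q c :=
  let ⟨A, hN, hc⟩ := h
  ⟨A, hN, hc.hasSymbolCocycle⟩

end Defs

/-- **Bridge stub of the line's vocabulary** (registered on the crux so that this definitions
file is creditable as a `--supports` file): a Nash symbol class of weight `q + 1` is a symbol class of
weight `q + 1` (forget that the units and relation witnesses are Nash). [folklore] -/
theorem stub_nashSymbolClass_isSymbolClass :
    ∀ ⦃n : ℕ⦄ ⦃X : SchemeOver ℂ⦄ (q : ℕ) (c : complexBetti X (2 * (q + 1))),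
      IsNashSymbolClass n X q c → IsSymbolClass n X q c :=
  fun _ _ _ _ h ↦ h.isSymbolClass

/-! ### The statements of the line -/

/-- **GK in named, guarded form** (census `GKNamed`): every rational symbol class of weight `q + 1`
on a smooth projective complex variety lies in `algebraicClasses X (q + 1)`. A route-posited
STATEMENT (the crux `SymbolClassesAlgebraic` over `IsSymbolClass`), not a result (hence untagged). -/
def GKNamed : Prop :=
  ∀ ⦃n : ℕ⦄ ⦃X : SchemeOver ℂ⦄, IsSmoothProjective n X →
    ∀ (q : ℕ) (c : complexBetti X (2 * (q + 1))), IsRationalClass c → IsSymbolClass n X q c →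
      c ∈ algebraicClasses X (q + 1)

/-- **`L ⊆ Hdg` in named, guarded form** (census `HodgeTypeNamed`; the route's support item
`SymbolClassesHodgeType`, stmt-HodgeConjecture-17746): rational symbol classes of weight `q + 1` are
of Hodge type `(q+1, q+1)`. Route-posited STATEMENT (untagged); stub (T) of the line. -/
def HodgeTypeNamed : Prop :=
  ∀ ⦃n : ℕ⦄ ⦃X : SchemeOver ℂ⦄, IsSmoothProjective n X →
    ∀ (q : ℕ) (c : complexBetti X (2 * (q + 1))), IsRationalClass c → IsSymbolClass n X q c →
      IsOfHodgeType n X (2 * (q + 1)) (q + 1) (q + 1) c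

/-- **(A) Nash descent**: on a smooth projective complex variety every rational symbol class is a
Nash symbol class (the line's transferred statement `C⁺_A`: nested Artin–Popescu–Lempert
approximation of the units of a symbol cocycle on the Čech nerve, exact by homotopy rigidity of the
transgressed class; Artin 1969 Thm. 1.10 for the henselian germ case). Route-posited STATEMENT
(untagged); stub (A), held by the lead. -/
def NashDescent : Prop :=
  ∀ ⦃n : ℕ⦄ ⦃X : SchemeOver ℂ⦄, IsSmoothProjective n X →
    ∀ (q : ℕ) (c : complexBetti X (2 * (q + 1))), IsRationalClass c → IsSymbolClass n X q c →
      IsNashSymbolClass n X q c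

/-- **(W₁) Weight kill — coniveau one for Nash symbol classes**: every rational Nash symbol class
of weight `q + 1` lies in `N¹ H^{2q+2} = supportedClasses X (2(q+1)) 1` (globalise the Nash units on
a finite étale cover of `X ∖ D`, `D` = branch + zero/pole divisor; Deligne's weights kill the class
on `X ∖ D`, Hodge II 3.2.15–17). Route-posited STATEMENT (untagged); stub (W₁), the card's "First lemma". -/
def NashSymbolConiveauOne : Prop :=
  ∀ ⦃n : ℕ⦄ ⦃X : SchemeOver ℂ⦄, IsSmoothProjective n X →
    ∀ (q : ℕ) (c : complexBetti X (2 * (q + 1))), IsRationalClass c → IsNashSymbolClass n X q c →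
      c ∈ supportedClasses X (2 * (q + 1)) 1

/-- **(W_alg, weights `≥ 3`)**: rational Nash symbol classes of weight `q + 1 ≥ 3` are algebraic
(Leray for `λ : W̄^an → W̄_Zar`, Bloch–Ogus (7.6), strictness). Route-posited STATEMENT (untagged); stub. -/
def NashSymbolClassesAlgebraicHigh : Prop :=
  ∀ ⦃n : ℕ⦄ ⦃X : SchemeOver ℂ⦄, IsSmoothProjective n X →
    ∀ (q : ℕ), 2 ≤ q → ∀ (c : complexBetti X (2 * (q + 1))), IsRationalClass c →
      IsNashSymbolClass n X q c → c ∈ algebraicClasses X (q + 1)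

/-- **(W_alg, all weights)**: rational Nash symbol classes are algebraic — the card's second conjunct
of `C⁺`; implied by (W₁), (T) and (W_alg, `≥ 3`) (`nashSymbolClassesAlgebraic_of_stubs` in the line's
workfile). Route-posited STATEMENT (untagged). -/
def NashSymbolClassesAlgebraic : Prop :=
  ∀ ⦃n : ℕ⦄ ⦃X : SchemeOver ℂ⦄, IsSmoothProjective n X →
    ∀ (q : ℕ) (c : complexBetti X (2 * (q + 1))), IsRationalClass c → IsNashSymbolClass n X q c →
      c ∈ algebraicClasses X (q + 1)

/-- **Alg ⊆ L_Nash**: rational algebraic symbol classes are Nash symbol classes (the Nash form of the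
route's support item AlgebraicClassesAreSymbolClasses: the Bloch–Quillen–Kerz / Koszul cocycles are
Zariski-regular, a fortiori Nash). Route-posited STATEMENT; not a stub of the composition, used only in
`nashDescent_of_gk` (untagged). -/
def AlgebraicClassesAreNashSymbolClasses : Prop :=
  ∀ ⦃n : ℕ⦄ ⦃X : SchemeOver ℂ⦄, IsSmoothProjective n X →
    ∀ (q : ℕ) (c : complexBetti X (2 * (q + 1))), IsRationalClass c →
      c ∈ algebraicClasses X (q + 1) → IsSymbolClass n X q c → IsNashSymbolClass n X q c

/-- **route GK ⇐ named GK** (the census bridge `route_of_gkNamed`: the inlined route decl is the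
named form with the `Nontrivial` guard dropped). [folklore] -/
theorem route_of_gkNamed (h : GKNamed) : Theses.MilnorKExponential.SymbolClassesAlgebraic := by
  intro n X hX q c hc hs
  obtain ⟨A, hN, ι, hι, U, hU, hcov, σ, hg, hco, θ, m, hm, hT, hdR⟩ := hs
  exact h hX q c hc ⟨A, fun _ ↦ hN, ι, hι, U, hU, hcov, σ, ⟨hg, hco⟩, θ, m, hm, hT, hdR⟩

/-- **named GK ⇒ route GK** (census `gkNamed_of_route`; the guard is void for `c ≠ 0`). [folklore] -/
theorem gkNamed_of_route (h : Theses.MilnorKExponential.SymbolClassesAlgebraic) : GKNamed := by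
  intro n X hX q c hc hs
  by_cases hc0 : c = 0
  · rw [hc0]; exact Submodule.zero_mem _
  obtain ⟨A, hN, hS⟩ := hs.exists_isSymbolNormalized hc0
  obtain ⟨ι, hι, U, hU, hcov, σ, ⟨hg, hco⟩, θ, m, hm, hT, hdR⟩ := hS
  exact h hX q c hc ⟨A, hN, ι, hι, U, hU, hcov, σ, hg, hco, θ, m, hm, hT, hdR⟩

/-! ### Why stub (A) is crux-sized (record) -/

/-- **(A) is GK through the comparison of sites**: GK and Alg ⊆ L_Nash imply Nash descent; with the
line's glue `A ∧ W_alg → GK` this is the card's `C⁺_A ⟺ GK` (modulo W_alg and Alg ⊆ L_Nash) — the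
record of why stub (A) is crux-sized. [folklore] -/
theorem nashDescent_of_gk (h : GKNamed) (hAlg : AlgebraicClassesAreNashSymbolClasses) : NashDescent :=
  fun _ _ hX q c hc hs ↦ hAlg hX q c hc (h hX q c hc hs) hs

end Summit.HodgeConjecture.HodgeConjecture.Theorems.MilnorKExponentialNash

end
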